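import Summits.QuantumAdvantage.QuantumAdvantage.Theorems.SosSandwichPseudoBoundedAAClassicalCornerFourierQueries
import Literature.Computability.Complexity.KKLTheorem
import HarnessLib

/-!
# Crux `PseudoBoundedAA` (stmt-QuantumAdvantage-15237, route SosSandwich) — classical corner: the SPECTRAL-`L¹` form of the
# `L²`-OSSS law, `16·Var[p]² ≤ 4·‖p̂‖₁ · Σⱼ δ̄ⱼ Infⱼ[p]`

Support file (`--supports stmt-QuantumAdvantage-15237`), sequel of `…ClassicalCornerFourierQueries.lean`
(`|S|·|p̂(S)| ≤ δ̄(S)` for nonnegative mixtures `p = Σ_k w_k[t_k accepts]` of decision trees).  Consequence, entirely in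
Fourier language on the cube (`cubeFourierCoeff`, `walsh`; `δ̄ⱼ = Σ_k w_k #{x : j ∈ t_k.queries x}/2^N`,
`Infⱼ[p] = E(p(x^{j→1}) − p(x^{j→0}))² = 4 Σ_{S∋j} p̂(S)²`):

* `sq_sum_sq_le_sum_abs_mul_sum_abs_cube` — `(Σ a²)² ≤ (Σ |a|)·(Σ |a|³)` (termwise `2a²b² ≤ |a||b|³ + |a|³|b|`);
* `sum_sq_mul_weight_eq` — `Σ_S p̂(S)²·Σ_{j∈S} δ̄ⱼ = ¼ Σⱼ δ̄ⱼ Infⱼ[p]` (O'Donnell Thm 2.20, via `KKL.avg_sq_coordDeriv`);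
* **`sixteen_var_sq_le_spectralL1_mul`** — `16·(Σ_{S≠∅} p̂(S)²)² ≤ 4·(Σ_{S≠∅} |p̂(S)|)·Σⱼ δ̄ⱼ·Infⱼ[p]`, with
  `varFourier_eq` identifying `Σ_{S≠∅} p̂(S)²` with `Var[p] = E p² − (E p)²`.

Reading.  Next to `C₀ = Ī` (average total influence of the trees, `…SensitivityOSSS.lean`) the census's `L²`-OSSS law
`16 Var² ≤ C₀ Σⱼδ̄ⱼInfⱼ` thus also holds with `C₀ = 4·‖p − E p‖_A` (Fourier algebra norm of the mixture) — a bound of a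
different nature: it is MIXTURE-AWARE (it rests on `|S||p̂(S)| ≤ δ̄(S)`, false for a general pair (tree, function) by
`not_exists_bilinear_osss`), though not uniform in the depth (`‖p̂‖₁ ≤ 2^T` for depth-`T` mixtures).  The dictator
mixture `p = (1/n)Σxᵢ` has `4‖p̂‖₁ = 2` against the true constant `1`.

Honest label: calibration inside the classical corner of an open conjecture; no stub, crux or summit is closed.
Sources: R. O'Donnell, *Analysis of Boolean Functions* (2014) Thm 2.20, §3.4, §8.6; O'Donnell–Saks–Schramm–Servedio,
FOCS 2005, Thm 3.2.
-/

set_option linter.dupNamespace false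

noncomputable section

namespace Summit.QuantumAdvantage.QuantumAdvantage.Theorems.SosSandwich

open Finset Function
open Literature.Computability.Complexity
open Literature.Probability.RandomGraphs.LowDegree (walsh sgn)
open Literature.Computability.Complexity.LowDegree (cubeFourierCoeff)

namespace ClassicalCornerSpectralL1

variable {N : ℕ}

/-- `(Σ a²)² ≤ (Σ |a|)·(Σ |a|³)` on any finset (termwise `2a²b² ≤ |a||b|(a² + b²)`). [folklore] -/
theorem sq_sum_sq_le_sum_abs_mul_sum_abs_cube {α : Type*} (s : Finset α) (a : α → ℝ) :
    (∑ i ∈ s, a i ^ 2) ^ 2 ≤ (∑ i ∈ s, |a i|) * ∑ i ∈ s, |a i| ^ 3 := by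
  rw [sq, Finset.sum_mul_sum, Finset.sum_mul_sum]
  -- symmetrise the right-hand side
  have hsym : ∑ i ∈ s, ∑ j ∈ s, |a i| * |a j| ^ 3 = ∑ i ∈ s, ∑ j ∈ s, |a j| * |a i| ^ 3 := Finset.sum_comm
  have h2 : 2 * ∑ i ∈ s, ∑ j ∈ s, |a i| * |a j| ^ 3 =
      ∑ i ∈ s, ∑ j ∈ s, (|a i| * |a j| ^ 3 + |a j| * |a i| ^ 3) := by
    rw [two_mul]
    nth_rw 2 [hsym]
    rw [← Finset.sum_add_distrib]
    refine Finset.sum_congr rfl fun i _ => ?_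
    rw [← Finset.sum_add_distrib]
  have hterm : ∀ i j, 2 * (a i ^ 2 * a j ^ 2) ≤ |a i| * |a j| ^ 3 + |a j| * |a i| ^ 3 := by
    intro i j
    have hx := abs_nonneg (a i); have hy := abs_nonneg (a j)
    have e : a i ^ 2 * a j ^ 2 = |a i| ^ 2 * |a j| ^ 2 := by rw [sq_abs, sq_abs]
    rw [e]
    nlinarith [mul_nonneg hx hy, sq_nonneg (|a i| - |a j|), mul_nonneg (mul_nonneg hx hy) (sq_nonneg (|a i| - |a j|))]
  have hle : 2 * ∑ i ∈ s, ∑ j ∈ s, a i ^ 2 * a j ^ 2 ≤ 2 * ∑ i ∈ s, ∑ j ∈ s, |a i| * |a j| ^ 3 := by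
    rw [h2, Finset.mul_sum]
    refine Finset.sum_le_sum fun i _ => ?_
    rw [Finset.mul_sum]
    exact Finset.sum_le_sum fun j _ => hterm i j
  linarith

/-- Exchange of summations: `Σ_S φ(S)·Σ_{j∈S} ψⱼ = Σⱼ ψⱼ·Σ_{S∋j} φ(S)`. [folklore] -/
theorem sum_mul_sum_mem_eq (φ : Finset (Fin N) → ℝ) (ψ : Fin N → ℝ) :
    ∑ S : Finset (Fin N), φ S * ∑ j ∈ S, ψ j =
      ∑ j, ψ j * ∑ S ∈ Finset.univ.filter (fun S : Finset (Fin N) => j ∈ S), φ S := by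
  classical
  have hL : ∑ S : Finset (Fin N), φ S * ∑ j ∈ S, ψ j =
      ∑ S : Finset (Fin N), ∑ j, (if j ∈ S then φ S * ψ j else 0) := by
    refine Finset.sum_congr rfl fun S _ => ?_
    rw [Finset.mul_sum, ← Finset.sum_filter]
    congr 1
    ext j; simp
  have hR : ∑ j, ψ j * ∑ S ∈ Finset.univ.filter (fun S : Finset (Fin N) => j ∈ S), φ S =
      ∑ j, ∑ S : Finset (Fin N), (if j ∈ S then φ S * ψ j else 0) := by
    refine Finset.sum_congr rfl fun j _ => ?_
    rw [Finset.mul_sum, ← Finset.sum_filter]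
    exact Finset.sum_congr rfl fun S _ => by ring
  rw [hL, hR, Finset.sum_comm]

/-- **`Σ_S p̂(S)²·Σ_{j∈S} δⱼ = ¼ Σⱼ δⱼ · E(p(x^{j→1}) − p(x^{j→0}))²`** for arbitrary weights `δ` and any real `P` on the
cube (O'Donnell Thm 2.20: `Σ_{S∋j} p̂(S)² = E(D_j p)²`). [cite: ODonnell2014, Thm 2.20] -/
theorem sum_sq_mul_weight_eq (P : (Fin N → Bool) → ℝ) (δ : Fin N → ℝ) :
    ∑ S : Finset (Fin N), cubeFourierCoeff P S ^ 2 * ∑ j ∈ S, δ j =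
      (∑ j, δ j * ((∑ x, (P (update x j true) - P (update x j false)) ^ 2) / (2 : ℝ) ^ N)) / 4 := by
  rw [sum_mul_sum_mem_eq, Finset.sum_div]
  refine Finset.sum_congr rfl fun j _ => ?_
  rw [← LowDegree.KKL.avg_sq_coordDeriv j P]
  have hD : ∀ x, (P (update x j true) - P (update x j false)) ^ 2 = 4 * LowDegree.KKL.coordDeriv j P x ^ 2 := by
    intro x
    rw [LowDegree.KKL.coordDeriv]
    ring
  rw [Finset.sum_congr rfl fun x _ => hD x, ← Finset.mul_sum]
  ring

/-- **Variance in Fourier terms**: `Σ_{S≠∅} p̂(S)² = E p² − (E p)²`. [cite: ODonnell2014, §1.4] -/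
theorem varFourier_eq (P : (Fin N → Bool) → ℝ) :
    ∑ S ∈ Finset.univ.filter (fun S : Finset (Fin N) => S.Nonempty), cubeFourierCoeff P S ^ 2 =
      (∑ x, P x ^ 2) / (2 : ℝ) ^ N - ((∑ x, P x) / (2 : ℝ) ^ N) ^ 2 := by
  classical
  rw [← LowDegree.sum_cubeFourierCoeff_sq, ← LowDegree.cubeFourierCoeff_empty]
  have hsplit := Finset.sum_filter_add_sum_filter_not Finset.univ (fun S : Finset (Fin N) => S.Nonempty)
    (fun S => cubeFourierCoeff P S ^ 2)
  have hempty : ∑ S ∈ Finset.univ.filter (fun S : Finset (Fin N) => ¬ S.Nonempty), cubeFourierCoeff P S ^ 2 =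
      cubeFourierCoeff P ∅ ^ 2 := by
    have hset : Finset.univ.filter (fun S : Finset (Fin N) => ¬ S.Nonempty) = {∅} := by
      ext S
      simp [Finset.not_nonempty_iff_eq_empty]
    rw [hset, Finset.sum_singleton]
  rw [← hsplit, hempty]
  ring

/-- **The spectral-`L¹` form of the `L²`-OSSS law on the classical corner.**  If `P = Σ_{k∈s} w_k·[t_k accepts]` with
`w_k ≥ 0` then, with `δ̄ⱼ = Σ_k w_k #{x : j ∈ t_k.queries x}/2^N`,
`16·(Σ_{S≠∅} P̂(S)²)² ≤ 4·(Σ_{S≠∅} |P̂(S)|) · Σⱼ δ̄ⱼ·E(P(x^{j→1}) − P(x^{j→0}))²`, i.e.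
`16·Var[P]² ≤ 4‖P − E P‖_A · Σⱼ δ̄ⱼ Infⱼ[P]`. [cite: ODonnell2014, §3.4, §8.6] -/
theorem sixteen_var_sq_le_spectralL1_mul {ι : Type*} (s : Finset ι) (w : ι → ℝ) (hw : ∀ k ∈ s, 0 ≤ w k)
    (t : ι → DecisionTree N) (P : (Fin N → Bool) → ℝ)
    (hP : ∀ x, P x = ∑ k ∈ s, w k * (if (t k).eval x = true then (1 : ℝ) else 0)) :
    16 * (∑ S ∈ Finset.univ.filter (fun S : Finset (Fin N) => S.Nonempty), cubeFourierCoeff P S ^ 2) ^ 2 ≤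
      4 * (∑ S ∈ Finset.univ.filter (fun S : Finset (Fin N) => S.Nonempty), |cubeFourierCoeff P S|) *
        ∑ j, (∑ k ∈ s, w k *
            (((Finset.univ.filter fun x : Fin N → Bool => j ∈ (t k).queries x).card : ℝ) / (2 : ℝ) ^ N)) *
          ((∑ x, (P (update x j true) - P (update x j false)) ^ 2) / (2 : ℝ) ^ N) := by
  classical
  set δ : Fin N → ℝ := fun j => ∑ k ∈ s, w k *
    (((Finset.univ.filter fun x : Fin N → Bool => j ∈ (t k).queries x).card : ℝ) / (2 : ℝ) ^ N) with hδ
  have hδ0 : ∀ j, 0 ≤ δ j := fun j =>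
    Finset.sum_nonneg fun k hk => mul_nonneg (hw k hk) (by positivity)
  -- Step 1: Cauchy–Schwarz-type inequality
  have h1 := sq_sum_sq_le_sum_abs_mul_sum_abs_cube
    (Finset.univ.filter (fun S : Finset (Fin N) => S.Nonempty)) (fun S => cubeFourierCoeff P S)
  -- Step 2: `|P̂(S)|³ ≤ P̂(S)² · δ̄(S)` for nonempty `S`
  have h2 : ∑ S ∈ Finset.univ.filter (fun S : Finset (Fin N) => S.Nonempty), |cubeFourierCoeff P S| ^ 3 ≤
      ∑ S ∈ Finset.univ.filter (fun S : Finset (Fin N) => S.Nonempty), cubeFourierCoeff P S ^ 2 * ∑ j ∈ S, δ j := by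
    refine Finset.sum_le_sum fun S hS => ?_
    rw [Finset.mem_filter] at hS
    have hcard : (1 : ℝ) ≤ S.card := by exact_mod_cast Finset.card_pos.mpr hS.2
    have hkey := ClassicalCornerFourierQueries.card_mul_abs_cubeFourierCoeff_le s w hw t P hP S
    have habs : |cubeFourierCoeff P S| ≤ ∑ j ∈ S, δ j := by
      have h0 : 0 ≤ |cubeFourierCoeff P S| := abs_nonneg _
      calc |cubeFourierCoeff P S| ≤ (S.card : ℝ) * |cubeFourierCoeff P S| := by nlinarith
        _ ≤ ∑ j ∈ S, δ j := hkey
    calc |cubeFourierCoeff P S| ^ 3 = cubeFourierCoeff P S ^ 2 * |cubeFourierCoeff P S| := by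
          rw [← sq_abs (cubeFourierCoeff P S)]; ring
      _ ≤ cubeFourierCoeff P S ^ 2 * ∑ j ∈ S, δ j := mul_le_mul_of_nonneg_left habs (sq_nonneg _)
  -- Step 3: drop the restriction to nonempty `S` and exchange summations
  have h3 : ∑ S ∈ Finset.univ.filter (fun S : Finset (Fin N) => S.Nonempty), cubeFourierCoeff P S ^ 2 * ∑ j ∈ S, δ j ≤
      ∑ S : Finset (Fin N), cubeFourierCoeff P S ^ 2 * ∑ j ∈ S, δ j :=
    Finset.sum_le_sum_of_subset_of_nonneg (Finset.filter_subset _ _)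
      fun S _ _ => mul_nonneg (sq_nonneg _) (Finset.sum_nonneg fun j _ => hδ0 j)
  have h4 := sum_sq_mul_weight_eq P δ
  have hL1 : 0 ≤ ∑ S ∈ Finset.univ.filter (fun S : Finset (Fin N) => S.Nonempty), |cubeFourierCoeff P S| :=
    Finset.sum_nonneg fun S _ => abs_nonneg _
  calc 16 * (∑ S ∈ Finset.univ.filter (fun S : Finset (Fin N) => S.Nonempty), cubeFourierCoeff P S ^ 2) ^ 2
      ≤ 16 * ((∑ S ∈ Finset.univ.filter (fun S : Finset (Fin N) => S.Nonempty), |cubeFourierCoeff P S|) *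
          ∑ S : Finset (Fin N), cubeFourierCoeff P S ^ 2 * ∑ j ∈ S, δ j) := by
        nlinarith [mul_le_mul_of_nonneg_left (h2.trans h3) hL1]
    _ = 4 * (∑ S ∈ Finset.univ.filter (fun S : Finset (Fin N) => S.Nonempty), |cubeFourierCoeff P S|) *
          ∑ j, δ j * ((∑ x, (P (update x j true) - P (update x j false)) ^ 2) / (2 : ℝ) ^ N) := by
        rw [h4]; ring

end ClassicalCornerSpectralL1

end Summit.QuantumAdvantage.QuantumAdvantage.Theorems.SosSandwich

end
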